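import Literature.NumberTheory.NumberFields.KummerGeneratorsUnramified
import Literature.NumberTheory.NumberFields.UnramifiedDescentPrimeDegree
import Literature.NumberTheory.NumberFields.RelativeDifferentExponents
import Literature.IUT.LogVolume.DifferentConductorTowerBounds
import Literature.IUT.LogVolume.IdealArithmeticDivisors
import HarnessLib

/-!
# [GenEll] Prop. 1.7 (i), right inequality, for RADICAL Galois covers: the log-different of
# `L = K(α : α^{d_α} ∈ K)` is bounded by the log-different plus the log-conductor of `K`

S. Mochizuki, *Arithmetic elliptic curves in general position*, Math. J. Okayama Univ. 52 (2010)
[cite: MochizukiGenEll2010, Prop 1.7 (i) p.9] (kurims manuscript, Feb. 2009), Prop. 1.7 (i)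
pp. 9–10, read on the page: for `φ : Y → Z` generically finite, étale over `U_Z = Z ∖ E`, with
ramification indices dividing `e`,

> `log-cond_E − log-cond_D ≲ log-diff_Y − log-diff_Z ≲ (1 − 1/e)·log-cond_E` on `U_Y(Q̄)`,

the proof of the RIGHT inequality being (p. 10) "the elementary theory of differents" at the tamely
ramified primes plus a uniform bound at the finitely many wild ones ("there exists a positive integer
`n` such that for any finite Galois extension `L/K` … with `[L : K] ≤ d`, the different ideal of
`L/K` contains `p^n·O_L`", via Kummer theory). In the proof of [GenEll] Thm. 2.1 (p. 11) `Y → ℙ¹` is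
a Galois covering ramified with index `e` exactly over the three cusps; for `ℙ¹` such coverings are
RADICAL (Kummer / Fermat): `L = K(ζ_e, a^{1/e})` with `a ∈ {x, 1−x, x(1−x), …}` a unit outside the
primes where `x` meets `0, 1, ∞`.

This file proves the number-field form of the right inequality for every such cover, with no
exceptional set and an explicit constant:

* `logdisc_le_of_adjoin_radicals` — for `L/K` a finite GALOIS extension of number fields generated
  by a set of radicals `α` (`α^{d_α} = a_α ∈ K`, `1 ≤ d_α ∣ D`) whose radicands `a_α` are units
  outside a finite set `S` of primes of `K`:
      `(1/[L:ℚ]) log|d_L| ≤ (1/[K:ℚ]) log|d_K| + (1/[K:ℚ]) Σ_{v∈S} log N(v)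
                             + Σ_{p ∣ D·[L:K]} (v_p([L:K]) + 1)·log p`,
  in the tree's vocabulary `ndeg L (differentDivisor L) ≤ ndeg K (differentDivisor K) +
  ndeg K (ADivisor.reduced S) + …` (`Literature.IUT.LogVolume.IdealArithmeticDivisors`:
  `ndeg F (differentDivisor F) = NFPoint.logDiff`, `ADivisor.reduced S` = the conductor `(D_x)_red`).
  Proof = the tree's Step (ii) engine
  `Literature.IUT.LogVolume.ndeg_different_add_reduced_le_of_isGalois` (tame places: Dedekind's
  `ord_w 𝔡 = e_w − 1` exactly pays the conductor; wild places over `p ∣ D·[L:K]`: Dedekind–Hensel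
  `ord_w 𝔡 < e_w·(v_p([L:K])+1)`), fed by `ramificationIdx_eq_one_of_adjoin_radicals`
  (`KummerGeneratorsUnramified`: unramified off `S` and off `p ∣ D`) and `e_w ∣ [L:K]` (Galois).

Theorems only; no definitions, no named facts. Consumers: the Kummer covers `D_e`, `F_e` of
`ℙ¹ ∖ {0,1,∞}` in the proof of [GenEll] Thm. 2.1 (route item GenEllTwo of the abc-iut cell).
-/

noncomputable section

open NumberField IsDedekindDomain Finset
open Literature.IUT.LogVolume

namespace Literature.NumberTheory.DiophantineGeometry.GenEll

variable (K L : Type*) [Field K] [NumberField K] [Field L] [NumberField L] [Algebra K L]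

/-- The finite set `T` of primes of `L` above a finite set `S` of primes of `K`, with the membership
criterion `w ∈ T ↔ w ∩ 𝓞 K ∈ S` used by the tree's tower bookkeeping. [folklore] -/
private theorem exists_finset_above (S : Finset (HeightOneSpectrum (𝓞 K))) :
    ∃ T : Finset (HeightOneSpectrum (𝓞 L)), ∀ w, w ∈ T ↔ finBelow K L w ∈ S := by
  classical
  refine ⟨S.biUnion fun v => (IsDedekindDomain.primesOverFinset v.asIdeal (𝓞 L)).preimage
    HeightOneSpectrum.asIdeal (fun _ _ _ _ h => HeightOneSpectrum.ext h), fun w => ?_⟩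
  simp only [Finset.mem_biUnion, Finset.mem_preimage]
  constructor
  · rintro ⟨v, hv, hw⟩
    rw [IsDedekindDomain.mem_primesOverFinset_iff v.ne_bot] at hw
    obtain ⟨_, hover⟩ := hw
    have : finBelow K L w = v := HeightOneSpectrum.ext hover.over.symm
    rwa [this]
  · intro hw
    refine ⟨finBelow K L w, hw, ?_⟩
    rw [IsDedekindDomain.mem_primesOverFinset_iff (finBelow K L w).ne_bot]
    exact ⟨w.isPrime, liesOver_finBelow K L w⟩

omit [NumberField L] in
/-- `(n : 𝓞 L) ∈ w` iff the residue characteristic of `w` divides `n`. [folklore] -/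
private theorem natCast_mem_iff_residueChar_dvd (w : HeightOneSpectrum (𝓞 L)) (n : ℕ) :
    (n : 𝓞 L) ∈ w.asIdeal ↔ residueChar L w ∣ n :=
  Literature.NumberTheory.NumberFields.natCast_mem_iff_absNorm_under_dvd L w.asIdeal n

/-- **[GenEll] Prop. 1.7 (i), right inequality, for radical Galois covers (number-field form).**
Let `L/K` be a finite Galois extension of number fields with `L = K(G)` for a set `G` of radicals:
each `α ∈ G` satisfies `α^{d} = a` for some `a ∈ K` and `1 ≤ d ∣ D`, where `a` is a unit at every
prime of `K` outside the finite set `S` ("`φ` is étale over `U_Z`", the radicands being units off the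
conductor). Then, with `N = [L:K]`,
`deg(𝔡^L) ≤ deg(𝔡^K) + deg(𝔣^K_S) + Σ_{p ∣ D·N} (v_p(N) + 1)·log p`
— normalised log-different of `L` ≤ that of `K` plus the normalised log-conductor `(1/[K:ℚ])Σ_{v∈S} log N(v)`
plus a constant depending only on `D` and `N` (the printed "`≲ (1 − 1/e)·log-cond_E`", with the
tame places paid exactly by Dedekind's `ord_w 𝔡 = e_w − 1` and the wild places, all over `p ∣ D·N`,
by the uniform bound of p. 10). [cite: MochizukiGenEll2010, Prop 1.7 (i) p.9] -/
theorem ndeg_differentDivisor_le_of_adjoin_radicals [IsGalois K L]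
    (S : Finset (HeightOneSpectrum (𝓞 K))) {G : Set L} (hG : IntermediateField.adjoin K G = ⊤)
    {D : ℕ} (hD : D ≠ 0)
    (hrad : ∀ α ∈ G, ∃ (d : ℕ) (a : K), d ≠ 0 ∧ d ∣ D ∧
      (∀ v : HeightOneSpectrum (𝓞 K), v ∉ S → v.valuation K a = 1) ∧ α ^ d = algebraMap K L a) :
    ndeg L (differentDivisor L) ≤ ndeg K (differentDivisor K) + ndeg K (ADivisor.reduced S) +
      ∑ p ∈ (D * Module.finrank K L).primeFactors,
        (((Module.finrank K L).factorization p + 1 : ℕ) : ℝ) * Real.log p := by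
  classical
  haveI : FiniteDimensional K L := Module.Finite.of_restrictScalars_finite ℚ K L
  set N := Module.finrank K L with hN
  have hN0 : N ≠ 0 := Module.finrank_pos.ne'
  obtain ⟨T, hT⟩ := exists_finset_above K L S
  set P : Finset ℕ := (D * N).primeFactors with hP
  have hPprime : ∀ p ∈ P, p.Prime := fun p hp => Nat.prime_of_mem_primeFactors hp
  -- unramified off `S` and off the residue characteristics in `P`
  have hunr : ∀ w : HeightOneSpectrum (𝓞 L), residueChar L w ∉ P → finBelow K L w ∉ S →
      w.asIdeal.ramificationIdx (𝓞 K) = 1 := by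
    intro w hp hS
    refine Literature.NumberTheory.NumberFields.ramificationIdx_eq_one_of_adjoin_radicals w hG ?_
    intro α hα
    obtain ⟨d, a, hd0, hdD, hunit, hpow⟩ := hrad α hα
    refine ⟨d, a, ?_, ?_, hpow⟩
    · -- `d ∉ w`: else the residue characteristic `p_w ∣ d ∣ D`, so `p_w ∈ P`
      intro hmem
      apply hp
      rw [natCast_mem_iff_residueChar_dvd] at hmem
      rw [hP, Nat.mem_primeFactors]
      exact ⟨residueChar_prime L w, (hmem.trans hdD).mul_right N, mul_ne_zero hD hN0⟩
    · exact hunit _ hS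
  -- tame off `P`: `e(w|v) ∣ N` and `p_w ∤ N`
  have htame : ∀ w : HeightOneSpectrum (𝓞 L), residueChar L w ∉ P → finBelow K L w ∈ S →
      ¬ residueChar L w ∣ w.asIdeal.ramificationIdx (𝓞 K) := by
    intro w hp _ hdvd
    haveI := w.isPrime
    haveI : (finBelow K L w).asIdeal.IsMaximal := (finBelow K L w).isMaximal
    have hdvdN : w.asIdeal.ramificationIdx (𝓞 K) ∣ N :=
      Literature.NumberTheory.NumberFields.ramificationIdx_dvd_finrank_of_isGalois
        (finBelow K L w).asIdeal w.asIdeal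
    apply hp
    rw [hP, Nat.mem_primeFactors]
    exact ⟨residueChar_prime L w, (hdvd.trans hdvdN).mul_left D, mul_ne_zero hD hN0⟩
  have h := ndeg_different_add_reduced_le_of_isGalois K L S T hT P hPprime hN0 (dvd_refl N)
    (fun p => N.factorization p) (fun p _ => le_rfl) hunr htame
  have hT0 : 0 ≤ ndeg L (ADivisor.reduced T) := ndeg_nonneg L (ADivisor.reduced_isEffective T)
  linarith

/-- **Log-different form** (`(1/[F:ℚ])·log|disc F|` as in [GenEll] Def. 1.5 (iii) / the tree's
`NFPoint.logDiff`): under the hypotheses of `ndeg_differentDivisor_le_of_adjoin_radicals`,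
`(1/[L:ℚ])·log|d_L| ≤ (1/[K:ℚ])·log|d_K| + (1/[K:ℚ])·log ∏_{v∈S} N(v) + Σ_{p ∣ D·[L:K]} (v_p([L:K])+1) log p`.
[cite: MochizukiGenEll2010, Prop 1.7 (i) p.9] -/
theorem logdisc_le_of_adjoin_radicals [IsGalois K L]
    (S : Finset (HeightOneSpectrum (𝓞 K))) {G : Set L} (hG : IntermediateField.adjoin K G = ⊤)
    {D : ℕ} (hD : D ≠ 0)
    (hrad : ∀ α ∈ G, ∃ (d : ℕ) (a : K), d ≠ 0 ∧ d ∣ D ∧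
      (∀ v : HeightOneSpectrum (𝓞 K), v ∉ S → v.valuation K a = 1) ∧ α ^ d = algebraMap K L a) :
    Real.log ((NumberField.discr L).natAbs) / Module.finrank ℚ L ≤
      Real.log ((NumberField.discr K).natAbs) / Module.finrank ℚ K +
      Real.log ((∏ v ∈ S, Ideal.absNorm v.asIdeal : ℕ) : ℝ) / Module.finrank ℚ K +
      ∑ p ∈ (D * Module.finrank K L).primeFactors,
        (((Module.finrank K L).factorization p + 1 : ℕ) : ℝ) * Real.log p := by
  have h := ndeg_differentDivisor_le_of_adjoin_radicals K L S hG hD hrad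
  rwa [ndeg_apply, ndeg_apply, ndeg_apply, degF_differentDivisor, degF_differentDivisor,
    ADivisor.degF_reduced] at h

/-- **Intermediate fields**: for `K ⊆ M ⊆ L` with `L/K` a radical Galois cover as in
`ndeg_differentDivisor_le_of_adjoin_radicals` (e.g. `M = K(a^{1/e}) ⊆ L = K(ζ_e, a^{1/e})`, the field
of definition of a point of the Kummer cover over `x`), the same bound holds for `M`, the
log-different being monotone in towers (`ndeg_differentDivisor_mono`, "the portion … of
`log-diff_Y − log-diff_Z` is `≥ 0`", p. 10). [cite: MochizukiGenEll2010, Prop 1.7 (i) p.9] -/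
theorem ndeg_differentDivisor_le_of_adjoin_radicals_tower (M : Type*) [Field M] [NumberField M]
    [Algebra K M] [Algebra M L] [IsScalarTower K M L] [IsGalois K L]
    (S : Finset (HeightOneSpectrum (𝓞 K))) {G : Set L} (hG : IntermediateField.adjoin K G = ⊤)
    {D : ℕ} (hD : D ≠ 0)
    (hrad : ∀ α ∈ G, ∃ (d : ℕ) (a : K), d ≠ 0 ∧ d ∣ D ∧
      (∀ v : HeightOneSpectrum (𝓞 K), v ∉ S → v.valuation K a = 1) ∧ α ^ d = algebraMap K L a) :
    ndeg M (differentDivisor M) ≤ ndeg K (differentDivisor K) + ndeg K (ADivisor.reduced S) +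
      ∑ p ∈ (D * Module.finrank K L).primeFactors,
        (((Module.finrank K L).factorization p + 1 : ℕ) : ℝ) * Real.log p :=
  (ndeg_differentDivisor_mono M L).trans (ndeg_differentDivisor_le_of_adjoin_radicals K L S hG hD hrad)

end Literature.NumberTheory.DiophantineGeometry.GenEll

end
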